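import Summits.MatrixMultiplication.OmegaCensus.STPPZoo313Checker
import Summits.MatrixMultiplication.OmegaCensus.STPPZoo313TableP4

/-!
# ω-census (abelian STPP census): certification rows of the (3,13)@61 two-above zoo — leaf ranges, part 72

HONEST FRAMING (pub-omega census; verbatim): lottery ticket; floor = certified bounds/negative ranges.
Census STRUCTURE (seat pub-omega-stpp-1 gen 33, 2026-08-29), family (b2).  Kernel rows for `zoo313_61_of_rows` (`STPPZoo313Theorem.lean`): the depth-first
zoo search `zooGo 61 zooTbl61 …` (`STPPZoo313Checker.lean`) split along the prefix tree of the difference sequence; sibling ranges of one node are decided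
in one `decide +kernel` (≤ 15 000 leaves each); node theorems glue their children (`List.range'_append`).  Generator: HOME
`pub-omega-stpp-1-g33/code/gen_zoo_rows.py`.  Nothing here is progress on `ω`.
-/

namespace Summit.MatrixMultiplication.OmegaCensus.CubeNB.S2

/-- Zoo rows: node [3, 1, 1, 1, 1, 1], children d ∈ [1, 38] (14973 leaves). [folklore] -/
theorem zooRow_r3_1_1_1_1_1_1_38 : ((List.range' 1 38).all fun d => cond (Nat.ble 2 d) (Nat.beq 2 0 || zooGo 61 zooTbl61 5 (51 - d) (2 - 1) (8 + d) (505 ||| (1 <<< (8 + d))) ((8 + d) :: [8, 7, 6, 5, 4, 3, 0])) (zooGo 61 zooTbl61 5 (51 - d) 2 (8 + d) (505 ||| (1 <<< (8 + d))) ((8 + d) :: [8, 7, 6, 5, 4, 3, 0]))) = true := by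
  decide +kernel

/-- Zoo rows: node [3, 1, 1, 1, 1, 1], children d ∈ [39, 46] (148 leaves). [folklore] -/
theorem zooRow_r3_1_1_1_1_1_39_8 : ((List.range' 39 8).all fun d => cond (Nat.ble 2 d) (Nat.beq 2 0 || zooGo 61 zooTbl61 5 (51 - d) (2 - 1) (8 + d) (505 ||| (1 <<< (8 + d))) ((8 + d) :: [8, 7, 6, 5, 4, 3, 0])) (zooGo 61 zooTbl61 5 (51 - d) 2 (8 + d) (505 ||| (1 <<< (8 + d))) ((8 + d) :: [8, 7, 6, 5, 4, 3, 0]))) = true := by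
  decide +kernel

/-- Zoo rows: node [3, 1, 1, 1, 1], children d ∈ [2, 46] (5985 leaves). [folklore] -/
theorem zooRow_r3_1_1_1_1_2_45 : ((List.range' 2 45).all fun d => cond (Nat.ble 2 d) (Nat.beq 2 0 || zooGo 61 zooTbl61 6 (52 - d) (2 - 1) (7 + d) (249 ||| (1 <<< (7 + d))) ((7 + d) :: [7, 6, 5, 4, 3, 0])) (zooGo 61 zooTbl61 6 (52 - d) 2 (7 + d) (249 ||| (1 <<< (7 + d))) ((7 + d) :: [7, 6, 5, 4, 3, 0]))) = true := by
  decide +kernel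

/-- Zoo rows: node [3, 1, 1, 1], children d ∈ [2, 46] (6975 leaves). [folklore] -/
theorem zooRow_r3_1_1_1_2_45 : ((List.range' 2 45).all fun d => cond (Nat.ble 2 d) (Nat.beq 2 0 || zooGo 61 zooTbl61 7 (53 - d) (2 - 1) (6 + d) (121 ||| (1 <<< (6 + d))) ((6 + d) :: [6, 5, 4, 3, 0])) (zooGo 61 zooTbl61 7 (53 - d) 2 (6 + d) (121 ||| (1 <<< (6 + d))) ((6 + d) :: [6, 5, 4, 3, 0]))) = true := by
  decide +kernel

/-- Zoo rows: node [3, 1, 1], children d ∈ [2, 46] (7965 leaves). [folklore] -/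
theorem zooRow_r3_1_1_2_45 : ((List.range' 2 45).all fun d => cond (Nat.ble 2 d) (Nat.beq 2 0 || zooGo 61 zooTbl61 8 (54 - d) (2 - 1) (5 + d) (57 ||| (1 <<< (5 + d))) ((5 + d) :: [5, 4, 3, 0])) (zooGo 61 zooTbl61 8 (54 - d) 2 (5 + d) (57 ||| (1 <<< (5 + d))) ((5 + d) :: [5, 4, 3, 0]))) = true := by
  decide +kernel

end Summit.MatrixMultiplication.OmegaCensus.CubeNB.S2
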